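import Literature.MathematicalPhysics.QuantumLattice.HubbardTorusPlaquetteDressedBound
import Literature.MathematicalPhysics.QuantumLattice.HubbardRectangularTorus
import HarnessLib

/-!
# The plaquette-dressed Slater bound on the even RECTANGULAR torus `(ℤ/2Mℤ) × (ℤ/2M'ℤ)`

Topic `MathematicalPhysics/QuantumLattice`, family `hubbard`. The rectangular companion of
`HubbardTorusPlaquetteDressedBound.lean` (square torus `(ℤ/2Mℤ)²`): the same instance of the abstract
dressed-cluster (local-unitary-cluster, LUC) variational bound `DressedCluster.groundEnergy_le` for
the Hubbard model on the rectangular torus `fermionRectTorusGraph (M * 2) (M' * 2)`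
(`HubbardRectangularTorus.lean`; vertex set `Fin (2M) ×ₗ Fin (2M')`, lexicographic Jordan–Wigner
order) tiled by the `M · M'` disjoint `2 × 2` plaquettes `{2c₁, 2c₁+1} × {2c₂, 2c₂+1}`,
`c = (c₁, c₂) ∈ ℤ/M × ℤ/M'`, `M, M' ≥ 2`:

* `rectCellSite c a = (2c₁ + a₀, 2c₂ + a₁)` — cell coordinates; the plaquette charts
  `rectCellEmb c : {0,1}² ↪ torus` have pairwise disjoint images; the link charts
  `rectLinkEmb c e : {0,1} × {0,1}² ↪ torus` cover the plaquette pair `(c, c + e)`;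
* `rect_adj_cellSite_iff'` — nearest-neighbour adjacency of the rectangular torus in cell
  coordinates: an edge of the plaquette 4-cycle (`PlaquetteLUC.plaquetteGraph`, same cell) or one
  of the two middle bonds between the plaquettes `c` and `c ± e` (`PlaquetteLUC.linkGraph e`) — the
  plaquette and link graphs on the offsets are those of the square file, reused verbatim;
* `rect_hamiltonian_eq_sum_cells_add_sum_links` — **cluster decomposition**
  `H_{2M × 2M'} = Σ_c Γ(rectCellEmb c) H_plaq + Σ_{c,e} Γ(rectLinkEmb c e) T_e`;
* `groundEnergyAt_rect_le_dressed` — **the bound**: for every orthogonal projection `P` on the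
  one-particle space of the torus with `tr P = N` and every family of particle-number conserving
  unitaries `u_c` of the plaquette Fock space,
  `E_{2M×2M'}(t, U; N) ≤ Re [ Σ_c Σ_{s,t} (u_cᴴ H_plaq u_c)_{st} ρ_P^{cell c}(s,t)
     + Σ_{c,e} Σ_{s,t} (V_{c,e}ᴴ T_e V_{c,e})_{st} ρ_P^{link c,e}(s,t) ]`,
  `V_{c,e} = Γ(inl) u_c · Γ(inr) u_{c+e}`, `ρ_P^φ = slaterRDM (P|_φ)` — an explicit polynomial in the
  window entries of `P` and the entries of the `u_c`, exactly evaluable in rational arithmetic.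

This is the soundness statement behind exact-ℚ "plaquette-LUC" upper certificates on non-square
tori (e.g. `16 × 8`), which the square theorem `PlaquetteLUC.groundEnergyAt_le_dressed` does not
cover. Sources: Bach–Lieb–Solovej 1994, eq. (2c.36) (variational principle for quasi-free states and
their unitary dressings) [BachLiebSolovej1994]; Bratteli–Robinson II §5.2.2 (CAR algebra, even
subalgebras commute at disjoint support — the light cone of the dressing) [BratteliRobinsonII1997];
LeBlanc et al. 2015, eq. (1) (the model and the benchmark geometries) [LeBlancEtAl2015]; the tiling is
elementary [folklore]. Everything is proved; definitions have bodies; no named facts. The tiling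
lemmas are file-private plumbing (Literature exports only the cited bound and the six chart
definitions it is stated with); `-- TODO(general form): t′ (next-nearest-neighbour) bonds — the two
diagonals of a plaquette are cell terms, the remaining diagonal bonds join the plaquettes c and
c + e₁, c + e₂, c + e₁ ± e₂ (corner links), same abstract theorem`.
-/

noncomputable section

namespace Literature.MathematicalPhysics.QuantumLattice

open Matrix Finset HubbardWave0 Literature.Probability.LatticeModels
open scoped ComplexOrder Function

namespace PlaquetteLUC

variable {M M' : ℕ}

/-! ### §1. Cell coordinates on the rectangular torus `(ℤ/2M) × (ℤ/2M')` -/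

/-- The site `(2c₁ + a₀, 2c₂ + a₁)` of the rectangular torus with plaquette index
`c = (c₁, c₂) ∈ ℤ/M × ℤ/M'` and offset `a ∈ {0,1}²` (`finProdFinEquiv (cᵢ, aᵢ) = aᵢ + 2cᵢ`). [folklore] -/
def rectCellSite (c : Fin M × Fin M') (a : FermionTorus 2 2) : Fin (M * 2) ×ₗ Fin (M' * 2) :=
  toLex (finProdFinEquiv (c.1, ofLex a 0), finProdFinEquiv (c.2, ofLex a 1))

/-- First coordinate of a cell site. [folklore] -/
@[simp] private theorem ofLex_rectCellSite_fst (c : Fin M × Fin M') (a : FermionTorus 2 2) :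
    (ofLex (rectCellSite c a)).1 = finProdFinEquiv (c.1, ofLex a 0) := rfl

/-- Second coordinate of a cell site. [folklore] -/
@[simp] private theorem ofLex_rectCellSite_snd (c : Fin M × Fin M') (a : FermionTorus 2 2) :
    (ofLex (rectCellSite c a)).2 = finProdFinEquiv (c.2, ofLex a 1) := rfl

/-- Two offsets of `{0,1}²` agree iff both coordinates agree. [folklore] -/
private theorem offset_eq_iff (a b : FermionTorus 2 2) : a = b ↔ ofLex a 0 = ofLex b 0 ∧ ofLex a 1 = ofLex b 1 := by
  constructor
  · rintro rfl; exact ⟨rfl, rfl⟩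
  · rintro ⟨h0, h1⟩
    refine ofLex.injective (funext fun i => ?_)
    fin_cases i
    · exact h0
    · exact h1

/-- `rectCellSite` is jointly injective. [folklore] -/
private theorem rectCellSite_inj {c c' : Fin M × Fin M'} {a b : FermionTorus 2 2} :
    rectCellSite c a = rectCellSite c' b ↔ c = c' ∧ a = b := by
  constructor
  · intro h
    have h1 := congrArg (fun p => (ofLex p).1) h
    have h2 := congrArg (fun p => (ofLex p).2) h
    simp only [ofLex_rectCellSite_fst, ofLex_rectCellSite_snd, EmbeddingLike.apply_eq_iff_eq,
      Prod.mk.injEq] at h1 h2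
    exact ⟨Prod.ext h1.1 h2.1, (offset_eq_iff a b).2 ⟨h1.2, h2.2⟩⟩
  · rintro ⟨rfl, rfl⟩; rfl

/-- Cell coordinates are a bijection `(ℤ/M × ℤ/M') × {0,1}² → (ℤ/2M) × (ℤ/2M')`. [folklore] -/
private theorem rectCellSite_bijective :
    Function.Bijective (fun p : (Fin M × Fin M') × FermionTorus 2 2 => rectCellSite p.1 p.2) := by
  rw [Fintype.bijective_iff_injective_and_card]
  refine ⟨fun p q h => Prod.ext (rectCellSite_inj.1 h).1 (rectCellSite_inj.1 h).2, ?_⟩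
  rw [Fintype.card_prod, Fintype.card_prod, Fintype.card_fin, Fintype.card_fin, card_rectSites]
  change M * M' * Fintype.card (Fin 2 → Fin 2) = _
  rw [Fintype.card_fun, Fintype.card_fin]
  ring

/-- The chart of the plaquette `c`: `a ↦ (2c₁ + a₀, 2c₂ + a₁)`. [folklore] -/
def rectCellEmb (c : Fin M × Fin M') : FermionTorus 2 2 ↪ Fin (M * 2) ×ₗ Fin (M' * 2) :=
  ⟨rectCellSite c, fun _ _ h => (rectCellSite_inj.1 h).2⟩

/-- `rectCellEmb c a = rectCellSite c a`. [folklore] -/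
@[simp] private theorem rectCellEmb_apply (c : Fin M × Fin M') (a : FermionTorus 2 2) :
    rectCellEmb c a = rectCellSite c a := rfl

/-- Distinct plaquettes are disjoint. [folklore] -/
private theorem disjoint_rectCellEmb {c c' : Fin M × Fin M'} (h : c ≠ c') :
    Disjoint ((univ : Finset (FermionTorus 2 2)).map (rectCellEmb c)) (univ.map (rectCellEmb c')) := by
  rw [Finset.disjoint_left]
  rintro x hx hx'
  obtain ⟨a, -, rfl⟩ := Finset.mem_map.1 hx
  obtain ⟨b, -, hb⟩ := Finset.mem_map.1 hx'
  exact h (rectCellSite_inj.1 hb).1.symm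

variable [NeZero M] [NeZero M']

/-- The unit step of the plaquette index in direction `e`: `(1, 0)` or `(0, 1)`. [folklore] -/
def rectDir (e : Fin 2) : Fin M × Fin M' := (if e = 0 then 1 else 0, if e = 0 then 0 else 1)

/-- The neighbouring plaquette index `c + e`. [folklore] -/
def rectShift (c : Fin M × Fin M') (e : Fin 2) : Fin M × Fin M' := c + rectDir e

/-- `c + e₀ = (c₁ + 1, c₂)`. [folklore] -/
@[simp] private theorem rectShift_zero (c : Fin M × Fin M') : rectShift c 0 = (c.1 + 1, c.2) := by
  ext <;> simp [rectShift, rectDir]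

/-- `c + e₁ = (c₁, c₂ + 1)`. [folklore] -/
@[simp] private theorem rectShift_one (c : Fin M × Fin M') : rectShift c 1 = (c.1, c.2 + 1) := by
  ext <;> simp [rectShift, rectDir]

omit [NeZero M'] in
/-- In `ℤ/M`, `M ≥ 2`, adding one moves. [folklore] -/
private theorem fin_add_one_ne (hM : 2 ≤ M) (x : Fin M) : x + 1 ≠ x := by
  intro h
  have h2 := congrArg Fin.val h
  rw [Fin.val_add, Fin.val_one', Nat.mod_eq_of_lt (by omega : 1 < M)] at h2
  have hx := x.isLt
  rcases Nat.lt_or_ge ((x : ℕ) + 1) M with hlt | hge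
  · rw [Nat.mod_eq_of_lt hlt] at h2; omega
  · have heq : (x : ℕ) + 1 = M := by omega
    rw [heq, Nat.mod_self] at h2; omega

/-- For `M, M' ≥ 2` a plaquette differs from its neighbours. [folklore] -/
private theorem rectShift_ne (hM : 2 ≤ M) (hM' : 2 ≤ M') (c : Fin M × Fin M') (e : Fin 2) : rectShift c e ≠ c := by
  intro h
  fin_cases e
  · exact fin_add_one_ne hM c.1 (by simpa using congrArg Prod.fst h)
  · exact fin_add_one_ne hM' c.2 (by simpa using congrArg Prod.snd h)

/-- The chart of the link window made of the plaquettes `c` (first copy) and `c + e` (second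
copy): `(i, a) ↦ rectCellSite (c + i e) a`. [folklore] -/
def rectLinkSite (c : Fin M × Fin M') (e : Fin 2) (p : Fin 2 ×ₗ FermionTorus 2 2) :
    Fin (M * 2) ×ₗ Fin (M' * 2) :=
  rectCellSite (if (ofLex p).1 = 0 then c else rectShift c e) (ofLex p).2

/-- `rectLinkSite` is injective for `M, M' ≥ 2`. [folklore] -/
private theorem rectLinkSite_injective (hM : 2 ≤ M) (hM' : 2 ≤ M') (c : Fin M × Fin M') (e : Fin 2) :
    Function.Injective (rectLinkSite c e) := by
  intro p q h
  rw [rectLinkSite, rectLinkSite, rectCellSite_inj] at h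
  obtain ⟨h1, h2⟩ := h
  have hi : (ofLex p).1 = (ofLex q).1 := by
    by_contra hne
    rcases Fin.eq_zero_or_eq_succ (ofLex p).1 with hp | ⟨k, hk⟩ <;>
      rcases Fin.eq_zero_or_eq_succ (ofLex q).1 with hq | ⟨l, hl⟩
    · exact hne (hp.trans hq.symm)
    · rw [hp, hl, if_pos rfl, if_neg (Fin.succ_ne_zero l)] at h1
      exact rectShift_ne hM hM' c e h1.symm
    · rw [hk, hq, if_neg (Fin.succ_ne_zero k), if_pos rfl] at h1
      exact rectShift_ne hM hM' c e h1
    · apply hne; rw [hk, hl, Fin.eq_zero k, Fin.eq_zero l]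
  exact ofLex.injective (Prod.ext hi h2)

/-- The link chart as an embedding (`M, M' ≥ 2`). [folklore] -/
def rectLinkEmb (hM : 2 ≤ M) (hM' : 2 ≤ M') (c : Fin M × Fin M') (e : Fin 2) :
    Fin 2 ×ₗ FermionTorus 2 2 ↪ Fin (M * 2) ×ₗ Fin (M' * 2) :=
  ⟨rectLinkSite c e, rectLinkSite_injective hM hM' c e⟩

/-- `rectLinkEmb` unfolded. [folklore] -/
@[simp] private theorem rectLinkEmb_apply (hM : 2 ≤ M) (hM' : 2 ≤ M') (c : Fin M × Fin M') (e : Fin 2)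
    (p : Fin 2 ×ₗ FermionTorus 2 2) :
    rectLinkEmb hM hM' c e p = rectCellSite (if (ofLex p).1 = 0 then c else rectShift c e) (ofLex p).2 := rfl

/-- The first copy of a link window is the plaquette `c`. [folklore] -/
private theorem inlCell_trans_rectLinkEmb (hM : 2 ≤ M) (hM' : 2 ≤ M') (c : Fin M × Fin M') (e : Fin 2) :
    inlCell.trans (rectLinkEmb hM hM' c e) = rectCellEmb c := by
  ext a
  simp [Function.Embedding.trans_apply]

/-- The second copy of a link window is the plaquette `c + e`. [folklore] -/
private theorem inrCell_trans_rectLinkEmb (hM : 2 ≤ M) (hM' : 2 ≤ M') (c : Fin M × Fin M') (e : Fin 2) :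
    inrCell.trans (rectLinkEmb hM hM' c e) = rectCellEmb (rectShift c e) := by
  ext a
  simp [Function.Embedding.trans_apply]

/-! ### §2. Rectangular-torus adjacency in cell coordinates -/

omit [NeZero M'] in
/-- One coordinate `u = a + 2c` of a ring `ℤ/2M`, `M ≥ 2`, in cell form: `u ~ v` on the ring iff the
two sites are the two offsets of one cell, or the bond `(c, 1) ~ (c + 1, 0)` between consecutive cells
(in either orientation). [folklore] -/
private theorem ringAdj_cell_iff (hM : 2 ≤ M) (c c' : Fin M) (a b : Fin 2) :
    ringAdj (M * 2) ((finProdFinEquiv (c, a) : Fin (M * 2)) : ℕ) ((finProdFinEquiv (c', b) : Fin (M * 2)) : ℕ) ↔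
      (c' = c ∧ a ≠ b) ∨ (a = 1 ∧ b = 0 ∧ c' = c + 1) ∨ (b = 1 ∧ a = 0 ∧ c = c' + 1) := by
  have ha := a.isLt; have hb := b.isLt; have hc := c.isLt; have hc' := c'.isLt
  have hstep : ∀ x y : Fin M, y = x + 1 ↔ ((y : ℕ) = x + 1 ∨ ((x : ℕ) + 1 = M ∧ (y : ℕ) = 0)) := by
    intro x y
    rw [Fin.ext_iff, Fin.val_add, Fin.val_one', Nat.mod_eq_of_lt (by omega : 1 < M)]
    rcases Nat.lt_or_ge ((x : ℕ) + 1) M with h | h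
    · rw [Nat.mod_eq_of_lt h]; omega
    · rw [show (x : ℕ) + 1 = M by omega, Nat.mod_self]; omega
  rw [hstep c c', hstep c' c]
  simp only [ringAdj, finProdFinEquiv_apply_val, ne_eq, Fin.ext_iff, Fin.val_zero, Fin.val_one]
  have hmod1 : ((a : ℕ) + 2 * c + 1) % (M * 2) =
      if (a : ℕ) + 2 * c + 1 < M * 2 then (a : ℕ) + 2 * c + 1 else 0 := by
    split_ifs with h
    · exact Nat.mod_eq_of_lt h
    · rw [show (a : ℕ) + 2 * c + 1 = M * 2 by omega, Nat.mod_self]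
  have hmod2 : ((b : ℕ) + 2 * c' + 1) % (M * 2) =
      if (b : ℕ) + 2 * c' + 1 < M * 2 then (b : ℕ) + 2 * c' + 1 else 0 := by
    split_ifs with h
    · exact Nat.mod_eq_of_lt h
    · rw [show (b : ℕ) + 2 * c' + 1 = M * 2 by omega, Nat.mod_self]
  rw [hmod1, hmod2]
  split_ifs <;> omega

/-- **Nearest-neighbour adjacency of the rectangular torus `(ℤ/2M) × (ℤ/2M')` in cell coordinates**
(`M, M' ≥ 2`), regrouped: an edge of the plaquette (same cell), or a middle bond to the next cell
`c + e`, or a middle bond from the previous cell (`c = c' + e`). [folklore] -/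
private theorem rect_adj_cellSite_iff' (hM : 2 ≤ M) (hM' : 2 ≤ M') (c c' : Fin M × Fin M') (a b : FermionTorus 2 2) :
    (fermionRectTorusGraph (M * 2) (M' * 2)).Adj (rectCellSite c a) (rectCellSite c' b) ↔
      (c' = c ∧ plaquetteGraph.Adj a b) ∨
        ∃ e : Fin 2, (c' = rectShift c e ∧ LinkMid e a b) ∨ (c = rectShift c' e ∧ LinkMid e b a) := by
  rw [fermionRectTorusGraph_adj_iff, ofLex_rectCellSite_fst, ofLex_rectCellSite_snd, ofLex_rectCellSite_fst,
    ofLex_rectCellSite_snd, ringAdj_cell_iff hM, ringAdj_cell_iff hM', EmbeddingLike.apply_eq_iff_eq,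
    EmbeddingLike.apply_eq_iff_eq, Prod.mk.injEq, Prod.mk.injEq, plaquetteGraph_adj, Fin.exists_fin_two,
    Fin.exists_fin_two]
  simp only [ne_eq, offset_eq_iff, LinkMid, Fin.forall_fin_two, Prod.ext_iff, rectShift_zero, rectShift_one, Fin.isValue,
    not_true_eq_false, false_implies, true_and, and_true, forall_true_left, one_ne_zero, zero_ne_one,
    not_false_eq_true]
  generalize ofLex a 0 = a0, ofLex a 1 = a1, ofLex b 0 = b0, ofLex b 1 = b1 at *
  -- orientation of the coordinate equalities, then a finite case analysis on the four offset bits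
  have e1 : c.1 = c'.1 ↔ c'.1 = c.1 := eq_comm
  have e2 : c.2 = c'.2 ↔ c'.2 = c.2 := eq_comm
  simp only [e1, e2]
  fin_cases a0 <;> fin_cases a1 <;> fin_cases b0 <;> fin_cases b1 <;> simp <;> tauto

/-! ### §3. The cluster decomposition of the rectangular-torus Hamiltonian -/

section Sums

variable {β : Type*} [AddCommMonoid β]

omit [NeZero M] [NeZero M'] in
/-- Summing over the rectangular torus in cell coordinates. [folklore] -/
private theorem sum_rectCellSite (f : Fin (M * 2) ×ₗ Fin (M' * 2) → β) :
    ∑ x, f x = ∑ c : Fin M × Fin M', ∑ a : FermionTorus 2 2, f (rectCellSite c a) := by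
  rw [← rectCellSite_bijective.sum_comp f, Fintype.sum_prod_type]

/-- **The indicator of rectangular-torus adjacency splits over plaquette edges and link bonds**
(pointwise form of the tiling; the alternatives are mutually exclusive for `M, M' ≥ 2`). [folklore] -/
private theorem ite_rect_adj_cellSite_eq (hM : 2 ≤ M) (hM' : 2 ≤ M') (c c' : Fin M × Fin M') (a b : FermionTorus 2 2)
    (x : β) :
    (if (fermionRectTorusGraph (M * 2) (M' * 2)).Adj (rectCellSite c a) (rectCellSite c' b) then x else 0) =
      (if c' = c ∧ plaquetteGraph.Adj a b then x else 0) +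
        ∑ e : Fin 2, ((if c' = rectShift c e ∧ LinkMid e a b then x else 0) +
          (if c = rectShift c' e ∧ LinkMid e b a then x else 0)) := by
  have hiff := rect_adj_cellSite_iff' hM hM' c c' a b
  rw [show (if (fermionRectTorusGraph (M * 2) (M' * 2)).Adj (rectCellSite c a) (rectCellSite c' b) then x else 0) =
      if (c' = c ∧ plaquetteGraph.Adj a b) ∨
        ∃ e : Fin 2, (c' = rectShift c e ∧ LinkMid e a b) ∨ (c = rectShift c' e ∧ LinkMid e b a) then x else 0
      from by simp only [hiff]]
  rw [ite_or_eq_add]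
  · congr 1
    rw [ite_exists_fin_two_eq_add]
    · refine Finset.sum_congr rfl fun e _ => ite_or_eq_add (fun h h' => ?_) x
      exact not_linkMid_of_linkMid (e' := e) h.2 h'.2
    · rintro (h | h) (h' | h')
      · exact not_linkMid_of_linkMid_of_ne (by decide) h.2 h'.2
      · exact not_linkMid_of_linkMid (e' := 1) h.2 h'.2
      · exact not_linkMid_of_linkMid (e' := 0) h'.2 h.2
      · exact not_linkMid_of_linkMid_of_ne (by decide) h.2 h'.2
  · rintro ⟨rfl, -⟩ ⟨e, ⟨h, -⟩ | ⟨h, -⟩⟩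
    · exact rectShift_ne hM hM' c' e h.symm
    · exact rectShift_ne hM hM' c' e h.symm

/-- The previous plaquette index `c - e`. [folklore] -/
private theorem eq_rectShift_iff (c c' : Fin M × Fin M') (e : Fin 2) :
    c = rectShift c' e ↔ c' = c - rectDir e := by
  rw [rectShift, eq_sub_iff_add_eq, eq_comm]

/-- `(c - e) + e = c`. [folklore] -/
private theorem rectShift_sub (c : Fin M × Fin M') (e : Fin 2) : rectShift (c - rectDir e) e = c := by
  rw [rectShift, sub_add_cancel]

/-- The bonds starting at a fixed site, in cell coordinates: intra-plaquette edges, bonds to the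
next plaquette `c + e`, bonds to the previous plaquette `c - e`. [folklore] -/
private theorem sum_ite_rect_adj_cellSite_eq (hM : 2 ≤ M) (hM' : 2 ≤ M')
    (X : Fin (M * 2) ×ₗ Fin (M' * 2) → Fin (M * 2) ×ₗ Fin (M' * 2) → β)
    (c : Fin M × Fin M') (a : FermionTorus 2 2) :
    (∑ y, if (fermionRectTorusGraph (M * 2) (M' * 2)).Adj (rectCellSite c a) y then X (rectCellSite c a) y else 0) =
      (∑ b : FermionTorus 2 2, if plaquetteGraph.Adj a b then X (rectCellSite c a) (rectCellSite c b) else 0) +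
        ∑ e : Fin 2, ((∑ b : FermionTorus 2 2,
            if LinkMid e a b then X (rectCellSite c a) (rectCellSite (rectShift c e) b) else 0) +
          ∑ b : FermionTorus 2 2,
            if LinkMid e b a then X (rectCellSite c a) (rectCellSite (c - rectDir e) b) else 0) := by
  rw [sum_rectCellSite]
  simp_rw [ite_rect_adj_cellSite_eq hM hM']
  simp only [Finset.sum_add_distrib]
  have hQ : (∑ c' : Fin M × Fin M', ∑ b : FermionTorus 2 2,
      if c' = c ∧ plaquetteGraph.Adj a b then X (rectCellSite c a) (rectCellSite c' b) else 0) =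
      ∑ b : FermionTorus 2 2, if plaquetteGraph.Adj a b then X (rectCellSite c a) (rectCellSite c b) else 0 := by
    rw [Finset.sum_comm]
    refine Finset.sum_congr rfl fun b _ => ?_
    simp only [ite_and]
    rw [Finset.sum_ite_eq' univ c, if_pos (mem_univ _)]
  have hR : (∑ c' : Fin M × Fin M', ∑ b : FermionTorus 2 2, ∑ e : Fin 2,
      if c' = rectShift c e ∧ LinkMid e a b then X (rectCellSite c a) (rectCellSite c' b) else 0) =
      ∑ e : Fin 2, ∑ b : FermionTorus 2 2,
        if LinkMid e a b then X (rectCellSite c a) (rectCellSite (rectShift c e) b) else 0 := by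
    rw [sum_sum_sum_comm]
    refine Finset.sum_congr rfl fun e _ => ?_
    rw [Finset.sum_comm]
    refine Finset.sum_congr rfl fun b _ => ?_
    simp only [ite_and]
    rw [Finset.sum_ite_eq' univ (rectShift c e), if_pos (mem_univ _)]
  have hS : (∑ c' : Fin M × Fin M', ∑ b : FermionTorus 2 2, ∑ e : Fin 2,
      if c = rectShift c' e ∧ LinkMid e b a then X (rectCellSite c a) (rectCellSite c' b) else 0) =
      ∑ e : Fin 2, ∑ b : FermionTorus 2 2,
        if LinkMid e b a then X (rectCellSite c a) (rectCellSite (c - rectDir e) b) else 0 := by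
    rw [sum_sum_sum_comm]
    refine Finset.sum_congr rfl fun e _ => ?_
    rw [Finset.sum_comm]
    refine Finset.sum_congr rfl fun b _ => ?_
    simp only [eq_rectShift_iff, ite_and]
    rw [Finset.sum_ite_eq' univ (c - rectDir e), if_pos (mem_univ _)]
  rw [hQ, hR, hS, ← Finset.sum_add_distrib]

/-- **Tiling of the rectangular-torus bonds**: a sum over the ordered nearest-neighbour pairs of
`(ℤ/2M) × (ℤ/2M')` is the sum over the ordered edges of the `M·M'` plaquettes plus, for every
plaquette `c` and direction `e`, the two middle bonds to the plaquette `c + e` in both orientations.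
[folklore] -/
private theorem sum_ite_rect_adj_eq (hM : 2 ≤ M) (hM' : 2 ≤ M')
    (X : Fin (M * 2) ×ₗ Fin (M' * 2) → Fin (M * 2) ×ₗ Fin (M' * 2) → β) :
    ∑ x, ∑ y, (if (fermionRectTorusGraph (M * 2) (M' * 2)).Adj x y then X x y else 0) =
      ∑ c : Fin M × Fin M', ∑ a : FermionTorus 2 2, ∑ b : FermionTorus 2 2,
          (if plaquetteGraph.Adj a b then X (rectCellSite c a) (rectCellSite c b) else 0) +
        ∑ c : Fin M × Fin M', ∑ e : Fin 2,
          ((∑ a : FermionTorus 2 2, ∑ b : FermionTorus 2 2,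
              if LinkMid e a b then X (rectCellSite c a) (rectCellSite (rectShift c e) b) else 0) +
            ∑ a : FermionTorus 2 2, ∑ b : FermionTorus 2 2,
              if LinkMid e b a then X (rectCellSite (rectShift c e) a) (rectCellSite c b) else 0) := by
  rw [sum_rectCellSite]
  simp_rw [sum_ite_rect_adj_cellSite_eq hM hM' X]
  simp only [Finset.sum_add_distrib]
  congr 1
  congr 1
  · refine Finset.sum_congr rfl fun c _ => ?_
    rw [Finset.sum_comm]
  · -- reindex the plaquette sum `c ↦ c + e` in the second family of link terms
    rw [sum_sum_sum_comm]
    conv_rhs => rw [Finset.sum_comm]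
    refine Finset.sum_congr rfl fun e _ => ?_
    rw [← Equiv.sum_comp (Equiv.addRight (rectDir (M := M) (M' := M') e))]
    refine Finset.sum_congr rfl fun c _ => ?_
    simp only [Equiv.coe_addRight, add_sub_cancel_right]
    rfl

/-- `sum_ite_rect_adj_eq` with the link bonds indexed by the pairs `ℓ = (c, e)`. [folklore] -/
private theorem sum_ite_rect_adj_eq' (hM : 2 ≤ M) (hM' : 2 ≤ M')
    (X : Fin (M * 2) ×ₗ Fin (M' * 2) → Fin (M * 2) ×ₗ Fin (M' * 2) → β) :
    ∑ x, ∑ y, (if (fermionRectTorusGraph (M * 2) (M' * 2)).Adj x y then X x y else 0) =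
      ∑ c : Fin M × Fin M', ∑ a : FermionTorus 2 2, ∑ b : FermionTorus 2 2,
          (if plaquetteGraph.Adj a b then X (rectCellSite c a) (rectCellSite c b) else 0) +
        ∑ ℓ : (Fin M × Fin M') × Fin 2,
          ((∑ a : FermionTorus 2 2, ∑ b : FermionTorus 2 2,
              if LinkMid ℓ.2 a b then X (rectCellSite ℓ.1 a) (rectCellSite (rectShift ℓ.1 ℓ.2) b) else 0) +
            ∑ a : FermionTorus 2 2, ∑ b : FermionTorus 2 2,
              if LinkMid ℓ.2 b a then X (rectCellSite (rectShift ℓ.1 ℓ.2) a) (rectCellSite ℓ.1 b) else 0) := by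
  rw [sum_ite_rect_adj_eq hM hM' X, Fintype.sum_prod_type (fun ℓ : (Fin M × Fin M') × Fin 2 =>
    ((∑ a : FermionTorus 2 2, ∑ b : FermionTorus 2 2,
        if LinkMid ℓ.2 a b then X (rectCellSite ℓ.1 a) (rectCellSite (rectShift ℓ.1 ℓ.2) b) else 0) +
      ∑ a : FermionTorus 2 2, ∑ b : FermionTorus 2 2,
        if LinkMid ℓ.2 b a then X (rectCellSite (rectShift ℓ.1 ℓ.2) a) (rectCellSite ℓ.1 b) else 0))]

end Sums

/-- **Cluster decomposition of the Hubbard Hamiltonian on the rectangular torus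
`(ℤ/2M) × (ℤ/2M')`** (`M, M' ≥ 2`):
`H = Σ_c Γ(rectCellEmb c) H_plaq(t,U) + Σ_{(c,e)} Γ(rectLinkEmb c e) T_e(t)`, with `H_plaq` the Hubbard
Hamiltonian of the plaquette 4-cycle and `T_e = hamiltonian (linkGraph e) t 0` the hopping across the
two bonds between the plaquettes `c` and `c + e`. [folklore] -/
private theorem rect_hamiltonian_eq_sum_cells_add_sum_links (hM : 2 ≤ M) (hM' : 2 ≤ M') (t U : ℝ) :
    hamiltonian (fermionRectTorusGraph (M * 2) (M' * 2)) t U =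
      ∑ c : Fin M × Fin M', fermionEmbed (rectCellEmb c) (hamiltonian plaquetteGraph t U) +
        ∑ ℓ : (Fin M × Fin M') × Fin 2,
          fermionEmbed (rectLinkEmb hM hM' ℓ.1 ℓ.2) (hamiltonian (linkGraph ℓ.2) t 0) := by
  simp_rw [fermionEmbed_hamiltonian, Complex.ofReal_zero, zero_smul, add_zero]
  rw [Finset.sum_add_distrib, ← Finset.smul_sum, ← Finset.smul_sum, ← Finset.smul_sum, hamiltonian,
    add_right_comm, ← smul_add]
  congr 2
  · -- hopping
    simp_rw [sum_ite_const_cond]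
    rw [sum_ite_rect_adj_eq' hM hM']
    congr 1
    refine Finset.sum_congr rfl fun ℓ _ => ?_
    rw [sum_ite_linkGraph_eq]
    simp only [rectLinkEmb_apply, ofLex_toLex, Fin.isValue, ↓reduceIte, one_ne_zero]
  · -- on-site repulsion
    rw [sum_rectCellSite]
    rfl

/-! ### §4. The bound -/

set_option maxHeartbeats 800000 in
/-- **The plaquette-dressed Slater (local-unitary-cluster) bound on the rectangular torus
`(ℤ/2M) × (ℤ/2M')`, `M, M' ≥ 2`.** For all real `t, U`, every orthogonal projection `P` on the
one-particle space of the torus with `tr P = N`, and every family of particle-number conserving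
unitaries `u_c` of the plaquette Fock space (`u_cᴴ u_c = 1`, `[N̂, u_c] = 0`),
`E_{2M×2M'}(t,U;N) ≤ Re [ Σ_c Σ_{s,t} (u_cᴴ H_plaq u_c)_{st} · slaterRDM (P|_{cell c}) s t
   + Σ_{(c,e)} Σ_{s,t} (V_{c,e}ᴴ T_e V_{c,e})_{st} · slaterRDM (P|_{link c,e}) s t ]`,
`V_{c,e} = Γ(inlCell) u_c · Γ(inrCell) u_{c+e}`: the energy of the dressed Slater determinant
`(∏_c Γ(rectCellEmb c) u_c) Φ_P`, an explicit polynomial in the window entries of `P` and the entries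
of the `u_c`. (`DressedCluster.groundEnergy_le` + `rect_hamiltonian_eq_sum_cells_add_sum_links`.)
[cite: BachLiebSolovej1994, eq. (2c.36)] -/
theorem groundEnergyAt_rect_le_dressed (hM : 2 ≤ M) (hM' : 2 ≤ M') (t U : ℝ)
    {P : Matrix (Orb (Fin (M * 2) ×ₗ Fin (M' * 2))) (Orb (Fin (M * 2) ×ₗ Fin (M' * 2))) ℂ}
    (hP : P.IsHermitian) (hPP : P * P = P) {N : ℕ} (htr : P.trace = N)
    (u : Fin M × Fin M' → Matrix (Finset (Orb (FermionTorus 2 2))) (Finset (Orb (FermionTorus 2 2))) ℂ)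
    (hu : ∀ c, (u c)ᴴ * u c = 1) (huN : ∀ c, Commute totalNumberOp (u c)) :
    groundEnergyAt (fermionRectTorusGraph (M * 2) (M' * 2)) t U N ≤
      ((∑ c : Fin M × Fin M', ∑ s : Finset (Orb (FermionTorus 2 2)), ∑ s' : Finset (Orb (FermionTorus 2 2)),
          ((u c)ᴴ * hamiltonian plaquetteGraph t U * u c) s s' *
            HartreeFock.slaterRDM (P.submatrix (fun a => orb (rectCellEmb c (ofLex a).1) (ofLex a).2)
              (fun a => orb (rectCellEmb c (ofLex a).1) (ofLex a).2)) s s') +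
        ∑ ℓ : (Fin M × Fin M') × Fin 2, ∑ s : Finset (Orb (Fin 2 ×ₗ FermionTorus 2 2)),
          ∑ s' : Finset (Orb (Fin 2 ×ₗ FermionTorus 2 2)),
            ((fermionEmbed inlCell (u ℓ.1) * fermionEmbed inrCell (u (rectShift ℓ.1 ℓ.2)))ᴴ *
                hamiltonian (linkGraph ℓ.2) t 0 *
              (fermionEmbed inlCell (u ℓ.1) * fermionEmbed inrCell (u (rectShift ℓ.1 ℓ.2)))) s s' *
            HartreeFock.slaterRDM (P.submatrix (fun a => orb (rectLinkEmb hM hM' ℓ.1 ℓ.2 (ofLex a).1) (ofLex a).2)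
              (fun a => orb (rectLinkEmb hM hM' ℓ.1 ℓ.2 (ofLex a).1) (ofLex a).2)) s s').re := by
  have hH := rect_hamiltonian_eq_sum_cells_add_sum_links hM hM' t U
  have h := DressedCluster.groundEnergy_le (φ := rectCellEmb) (hdisj := fun _ _ h => disjoint_rectCellEmb h)
    (u := u) (huN := huN) (ψ := fun ℓ : (Fin M × Fin M') × Fin 2 => rectLinkEmb hM hM' ℓ.1 ℓ.2)
    (src := fun ℓ => ℓ.1) (tgt := fun ℓ => rectShift ℓ.1 ℓ.2) (ι₁ := inlCell) (ι₂ := inrCell)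
    (hne := fun ℓ => (rectShift_ne hM hM' ℓ.1 ℓ.2).symm) (hsrc := fun ℓ => inlCell_trans_rectLinkEmb hM hM' ℓ.1 ℓ.2)
    (htgt := fun ℓ => inrCell_trans_rectLinkEmb hM hM' ℓ.1 ℓ.2) (hcover := mem_range_inlCell_or_inrCell)
    hP hPP htr (hu := fun c => by convert hu c) (H := hamiltonian (fermionRectTorusGraph (M * 2) (M' * 2)) t U)
    (h₁ := fun _ => hamiltonian plaquetteGraph t U) (h₂ := fun ℓ => hamiltonian (linkGraph ℓ.2) t 0) hH
  rw [groundEnergyAt]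
  convert h using 3

end PlaquetteLUC

end Literature.MathematicalPhysics.QuantumLattice
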